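import Literature.NumberTheory.GaloisCohomology.PoitouTateIsPerfect
import Literature.NumberTheory.GaloisRepresentations.LocalGlobalCohomologyTateProofs
import Literature.AnabelianGeometry.AbsoluteAnabelian.LocalResidueMapQmodZ
import HarnessLib

/-!
# The local invariant map `inv_v : H²(K_v, μₙ) ⥲ ℤ/n` at a finite place of a number field

Let `K` be a number field, `n ≥ 1` and `v` a finite place.  Local class field theory provides THE
invariant map `inv_v : Br(K_v) ⥲ ℚ/ℤ` (Serre, *Corps locaux* XIII §3, XIV §1; Milne, *ADT* I §1,
Ex. 1.6 (b); Harari Thm. 8.9), whose restriction to `H²(K_v, μₙ) = Br(K_v)[n]` (Kummer theory,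
Hilbert 90) is a bijection onto `(1/n)ℤ/ℤ = ℤ/n` (Harari Prop. 8.13), normalised by
`inv_v(χ ∪ δπ) = v(π)·χ(Frob) = 1` for the unramified character `χ` with `χ(Frob) = 1` and a
uniformiser `π` (Serre XIV §1 Prop. 3 with XIII §4 Prop. 13).

The tree CONSTRUCTS this map for every non-archimedean local field `F` of characteristic `0`, in
the anabelian namespace: `Literature.AnabelianGeometry.AbsoluteAnabelian.Prop121vii.invLevel F n :
H²(Γ_F, μₙ(F̄)) →+ ℤ/n`, the unique map with `Prop121vii.IsInvariantMap F n` (bijective, with the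
unramified normalisation; `isInvariantMap_invLevel`, `eq_invLevel`, `existsUniqueInvariantMap_holds`).
The Poitou–Tate file of the tree (`PoitouTate.lean`) speaks instead of FAMILIES
`inv : LocalInvariants K n = ∀ v : Place K, H²(Γ_{K_v}, μₙ(K̄)|_{Γ_{K_v}}) →+ ℤ/n` on the localised
coefficients `(mu K n).toLocal v` (roots of unity of `K̄` restricted along `Γ_{K_v} → Γ_K`, NOT
`μₙ(K̄_v)`), and its named fact `poitouTate_sum_localTatePairing_eq_zero K` asserts the EXISTENCE of
a family with local duality and the Poitou–Tate vanishing.  This file transports the constructed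
map to that dialect:

* `localInvariantMap K n v : H²(Γ_{K_v}, μₙ(K̄)|) →+ ℤ/n` — **definition with body**:
  `invLevel (K_v) n` precomposed with the isomorphism on `H²` induced by
  `μₙ(K̄)|_{Γ_{K_v}} ≅ μₙ(K̄_v)` (`muLocalIso v n`, the chosen embedding `K̄ → K̄_v`;
  `continuousCohomologyEquivOfIso`);
* `localInvariantMap_bijective` (from `IsInvariantMap`), hence
  `LocalInvariants.isPerfect_of_eq_localInvariantMap`: every family whose finite components are the
  `localInvariantMap`s is a local Tate duality at the finite places (`LocalInvariants.IsPerfect`,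
  by `LocalInvariants.isPerfect_of_bijective` of `PoitouTateIsPerfect.lean`);
* `poitouTate_sum_localTatePairing_eq_zero_of_localInvariantMap` — **the named fact reduces to the
  reciprocity law of the Brauer group for THE invariant maps**: it holds as soon as, for every
  `n ≥ 1`, some family extending the `localInvariantMap`s (its components at the infinite places
  being free) satisfies `∑_v inv_v (loc_v c) = 0` on `H²(K, μₙ)`
  (`LocalInvariants.SumInvLocalizationEqZero`) — the Albert–Brauer–Hasse–Noether relation for the
  class-field-theoretic normalisation (Tate, Cassels–Fröhlich VII §9.6, §10, §11.2 (bis); Harari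
  Thm. 14.11), which is what remains to be proved in the tree to discharge the fact.

## Design notes

* Why only the finite places.  `LocalInvariants K n` is indexed by all places; at a complex place
  `H²(K_w, μₙ) = 0`, and at a real place the class-field-theoretic component is "the unique
  injection" `Br(ℝ) = ½ℤ/ℤ ↪ ℚ/ℤ` (Milne I Ex. 1.6 (c); the tree's predicate
  `LocalInvariants.InjectiveAtRealPlaces`, file `PoitouTateSelmerStructuresRealPlaces.lean`).  The
  archimedean components are not constructed here; the reduction theorem leaves them free, to be
  fixed by whoever proves the sum relation (for a totally complex `K` there is nothing to fix).
* The transported map is stated on `galoisCohomology ((mu K n).toLocal (Sum.inr v)) 2`; the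
  identification of `NumberField.Place.Completion (Sum.inr v)` with Mathlib's `v.adicCompletion K`
  is definitional but not syntactic (as in `LocalGlobalCohomologyTateProofs.lean`).
* No new named fact, no instance (D-0026); the only new definition is the transport.

## References

* J.-P. Serre, *Corps locaux* / *Local Fields* (1979), XIII §3 (Prop. 6–7, Cor. 1–3), XIII §4
  Prop. 13, XIV §1 Prop. 3. [SerreLocalFields1979]
* J. S. Milne, *Arithmetic Duality Theorems*, 2nd ed. (2006), Ch. I §1 (`inv_v`), Ex. 1.6 (b),(c),
  Cor. 2.3, Thm. 4.10(b). [MilneADT2006]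
* D. Harari, *Galois Cohomology and Class Field Theory* (2020), Thm. 8.9, Prop. 8.13, Thm. 14.11.
  [Harari2020]
* S. Mochizuki, *The absolute anabelian geometry of hyperbolic curves* (2004), Prop. 1.2.1 (vii)
  — the source formalised by the tree's `Prop121vii.invLevel`. [MochizukiAbsAnab2004]

## Tree search

`lean search 'localInvariantMap|isPerfect_of_eq|of_localInvariantMap'`: no prior declaration.
Inputs: `Prop121vii.invLevel`, `Prop121vii.isInvariantMap_invLevel` (LocalResidueMapQmodZ),
`muLocalIso` (LocalGlobalCohomologyTateProofs), `continuousCohomologyEquivOfIso`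
(TateDualityCounting), `LocalInvariants.isPerfect_of_bijective`,
`poitouTate_sum_localTatePairing_eq_zero_of_sumInvLocalizationEqZero` (PoitouTateIsPerfect).
-/

noncomputable section

open CategoryTheory Function NumberField IsDedekindDomain
open scoped NumberField

universe u

namespace Literature.NumberTheory.GaloisCohomology

open _root_.ContinuousCohomology
open Literature.NumberTheory.GaloisRepresentations
open Literature.NumberTheory.GaloisRepresentations.DiscreteGaloisModule (mu)
open Literature.AnabelianGeometry.AbsoluteAnabelian (Prop121vii.invLevel
  Prop121vii.isInvariantMap_invLevel)

-- `Prop121vii.invLevel (K_v) n` needs `CharZero K_v`; Mathlib's `v.adicCompletion K` carries no such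
-- instance, the tree proves it (`charZero_adicCompletion`).  It is supplied by `haveI` inside the
-- bodies below (no `attribute [local instance]`, no new instance).

variable (K : Type u) [Field K] [NumberField K] (n : ℕ) [NeZero n]

/-- **The local invariant map `inv_v : H²(K_v, μₙ) → ℤ/n` at the finite place `v`** of the number
field `K`, on the tree's localised coefficients `μₙ(K̄)|_{Γ_{K_v}}` (`(mu K n).toLocal (Sum.inr v)`):
THE residue map `Prop121vii.invLevel (K_v) n : H²(Γ_{K_v}, μₙ(K̄_v)) → ℤ/n` of the local field
`K_v` (the unique bijection with the unramified normalisation `inv(χ ∪ δπ) = 1`,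
`Prop121vii.IsInvariantMap`) precomposed with the isomorphism on `H²` induced by
`μₙ(K̄)|_{Γ_{K_v}} ≅ μₙ(K̄_v)` along the chosen embedding `K̄ → K̄_v` (`muLocalIso v n`).  In the
sources: the invariant map `inv_v : Br(K_v) ⥲ ℚ/ℤ` of local class field theory restricted to
`H²(K_v, μₙ) = Br(K_v)[n] ⥲ (1/n)ℤ/ℤ = ℤ/n`.
Ref: Serre, *Corps locaux* (1979), XIII §3 Cor. 3 and XIV §1 Prop. 3; Milne, *ADT* (2006), I §1
and Ex. 1.6 (b); Harari, *Galois Cohomology and Class Field Theory*, Thm. 8.9, Prop. 8.13.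
[cite: SerreLocalFields1979, XIII §3 Cor. 3, XIV §1 Prop. 3] -/
def localInvariantMap (v : HeightOneSpectrum (𝓞 K)) :
    galoisCohomology ((mu K n).toLocal (Sum.inr v)) 2 →+ ZMod n :=
  haveI : CharZero (v.adicCompletion K) := charZero_adicCompletion v
  (Prop121vii.invLevel (v.adicCompletion K) n).comp
    (cohomologyMap (muLocalIso v n).hom 2).hom.toLinearMap.toAddMonoidHom

variable {K n}

/-- Unfolding `localInvariantMap`: its value on a class is `invLevel (K_v) n` of the transported
class (for any `CharZero K_v` instance in scope — a proposition, so all instances agree).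
[cite: SerreLocalFields1979, XIII §3 Cor. 3] -/
theorem localInvariantMap_apply (v : HeightOneSpectrum (𝓞 K)) [CharZero (v.adicCompletion K)]
    (c : galoisCohomology ((mu K n).toLocal (Sum.inr v)) 2) :
    localInvariantMap K n v c =
      Prop121vii.invLevel (v.adicCompletion K) n ((cohomologyMap (muLocalIso v n).hom 2).hom c) :=
  rfl

/-- **`inv_v : H²(K_v, μₙ) → ℤ/n` is bijective** (`H²(K_v, μₙ) = Br(K_v)[n] ≅ ℤ/n`): the residue
map of `K_v` is bijective (`Prop121vii.IsInvariantMap`, first clause) and the transport along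
`muLocalIso` is an isomorphism on `H²` (`continuousCohomologyEquivOfIso`).
Ref: Serre, *Corps locaux* (1979), XIII §3 Cor. 3; Harari, *Galois Cohomology and Class Field
Theory*, Prop. 8.13. [cite: SerreLocalFields1979, XIII §3 Cor. 3] -/
theorem localInvariantMap_bijective (v : HeightOneSpectrum (𝓞 K)) :
    Bijective (localInvariantMap K n v) :=
  haveI : CharZero (v.adicCompletion K) := charZero_adicCompletion v
  (Prop121vii.isInvariantMap_invLevel (v.adicCompletion K) n).1.comp
    (continuousCohomologyEquivOfIso (muLocalIso v n) 2).bijective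

namespace LocalInvariants

/-- **A family of local invariant maps whose finite components are THE invariant maps is a local
Tate duality at the finite places** (`LocalInvariants.IsPerfect`: `inv_v` bijective and the
pairings `(x, y) ↦ inv_v (x ∪ y) : H¹(K_v, M) × H¹(K_v, M^D) → ℤ/n` perfect for every finite
`n`-torsion `M`) — by `localInvariantMap_bijective` and `LocalInvariants.isPerfect_of_bijective`
(the tree's local Tate duality, Milne I Cor. 2.3, transferred to any bijective `inv_v`).
Ref: Milne, *Arithmetic Duality Theorems* (2006), I Cor. 2.3; Harari, *Galois Cohomology and
Class Field Theory*, Prop. 8.13, Thm. 10.9. [cite: MilneADT2006, Ch. I, Cor. 2.3] -/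
theorem isPerfect_of_eq_localInvariantMap (inv : LocalInvariants K n)
    (h : ∀ v : HeightOneSpectrum (𝓞 K), inv (Sum.inr v) = localInvariantMap K n v) :
    inv.IsPerfect :=
  inv.isPerfect_of_bijective fun v => (h v).symm ▸ localInvariantMap_bijective v

end LocalInvariants

variable (K) in
/-- **Poitou–Tate (as vendored) from the reciprocity law of the Brauer group for THE invariant
maps.**  If for every `n ≥ 1` there is a family of local invariant maps whose component at every
FINITE place `v` is the invariant map `localInvariantMap K n v` of local class field theory (the
components at the infinite places being free — in the sources: `0` at a complex place and the
injection `Br(ℝ)[n] ↪ ℤ/n` at a real one) and which satisfies `∑_v inv_v (loc_v c) = 0` for every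
`c ∈ H²(K, μₙ)` (`LocalInvariants.SumInvLocalizationEqZero`: over every finite set of places outside
which the terms vanish), then `poitouTate_sum_localTatePairing_eq_zero K` holds
(`poitouTate_sum_localTatePairing_eq_zero_of_sumInvLocalizationEqZero` with
`localInvariantMap_bijective`).  The hypothesis is the middle exactness-as-a-complex of the
Albert–Brauer–Hasse–Noether sequence `0 → Br K → ⊕_v Br K_v → ℚ/ℤ → 0` on `Br(K)[n] = H²(K, μₙ)`
(Tate, Cassels–Fröhlich VII §9.6, §10, §11.2 (bis); Harari Thm. 14.11) — exactly what remains to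
be proved in the tree to discharge the fact, now for ONE pinned normalisation at the finite places.
Ref: Milne, *Arithmetic Duality Theorems* (2006), I Thm. 4.10(b) and its proof; Harari, *Galois
Cohomology and Class Field Theory*, Thm. 14.11, Rem. 14.12, Thm. 17.13.
[cite: MilneADT2006, Ch. I, Thm. 4.10(b)] -/
theorem poitouTate_sum_localTatePairing_eq_zero_of_localInvariantMap
    (h : ∀ (n : ℕ) [NeZero n], ∃ inv : LocalInvariants K n,
      (∀ v : HeightOneSpectrum (𝓞 K), inv (Sum.inr v) = localInvariantMap K n v) ∧
        inv.SumInvLocalizationEqZero) :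
    poitouTate_sum_localTatePairing_eq_zero K :=
  poitouTate_sum_localTatePairing_eq_zero_of_sumInvLocalizationEqZero fun n _ =>
    let ⟨inv, hinv, hsum⟩ := h n
    ⟨inv, fun v => (hinv v).symm ▸ localInvariantMap_bijective v, hsum⟩

end Literature.NumberTheory.GaloisCohomology

end
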